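import Literature.NumberTheory.LFunctions.Zhang2022.KnifeEdgeWallBand
import Literature.NumberTheory.LFunctions.Zhang2022.KnifeEdgeTwoBlockCriterion
import Literature.NumberTheory.LFunctions.Zhang2022.RepairRplusTightness

/-!
# Zhang (2022), programme F-S3 §E (cell landau-siegel, barrier extension, seat p3, stub S-E-p3-3): the WALL/BAND
# family of B-multi's live sub-class M3 — wall value `u(1⁻)` FREE — wrapped into the `R⁺⁺` protocol
# (`familyWallBand`, decided), as an instance of the two-block criterion

Y. Zhang, *Discrete mean estimates and the Landau–Siegel zero*, arXiv:2211.02515v1 [Zhang2022LandauSiegel] —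
an unrefereed manuscript under adjudication. **WHAT THIS IS NOT: not a claim about Theorems 1–2 of
arXiv:2211.02515, about Landau–Siegel zeros, about a repaired `Margin232`, or about Parity; nothing here asserts any
claim of the manuscript or any estimate. The programme SEARCHES and TYPES; no claim until a kernel theorem says so.**
Companion of `KnifeEdgeWallBand` (p458037, ls-Bmulti-typer-1: `KnifeEdge.WallData`, `KnifeEdge.bandK`,
`KnifeEdge.wallMainTerm`, `KnifeEdge.WallCrossCS`, `KnifeEdge.EMultiBandCloses`, `KnifeEdge.WallCrossNeg`, and the
PROVED bookkeeping `KnifeEdge.wallMainTerm_nonneg_of_cs`, `KnifeEdge.not_eMultiBandCloses_of_cs`,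
`KnifeEdge.eMultiBandCloses_of_crossNeg`), of `KnifeEdgeTwoBlockCriterion` (p458738: `KnifeEdge.TwoBlockWorld`,
`KnifeEdge.TwoBlockWorld.null_iff`) and of `RepairRplus` (p455670: `Repair.DesignFamily`, `Repair.rplus_extend`).

**The class (B-multi PLAN v1.1 §9.1 (L-a.ii) = M3, §9.7 «object of record = the design truncated at the wall»;
OBJECTIVE §1.3 (O1)).** A WALL/BAND DESIGN is `(u, u′, W)`: an in-class kinked `H¹` piece `u` on `[0,1]`
(`Repair.KinkedProfile u u'`) whose WALL VALUE `h⁻ = u(1)` is FREE — this is the coverage the first extension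
(`Repair.not_repairable_in_Rplus`, class `R⁺`: `InClassPiece.vanish`, `u(1) = 0`) and the rough two-piece family
(`KnifeEdge.familyRoughTwoPiece`, p457552: in-class side still `InClassPiece`) do not have — continued across the wall
by the band datum `W : WallData = (h⁺, b)` (height `h⁺ = g(1⁺)`, band shape `b` on the band coordinate
`w ∈ [0,1]`). NO analytic hypothesis is part of the class.

**The verdict (slot-conditional, currency = the (A)-world MODEL main term of row E-034).** For EVERY band functional
`K ≥ 0` (slot E-005/E-034 with its (B1) sign; DISCHARGED for the typed functional `K = bandK` by `bandK_nonneg`) and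
EVERY bulk × band cross world `X : WallCross` that is Cauchy–Schwarz-subordinate (`WallCrossCS K X`, slot E-006 in
its (B1) form, kind (c)), the completed constant `wallMainTerm K X u u' W = 𝔅(u) + 2Re X(u,W) + |h⁺|²K[b]` is NOT
negative (`familyWallBand`, `familyWallBand_decided` — by `wallMainTerm_nonneg_of_cs`, nothing re-proved;
`rplus_wallBand_decided : ClassDecided (Rplus ++ [familyWallBand])`). HONEST READING: closing in M3 needs
`¬(K ≥ 0 ∧ WallCrossCS K X)` — a negative band variance (against (B1)) or a cross term beyond its own Cauchy–Schwarz
maximum, row E-035 (`KnifeEdge.eMultiBandCloses_of_crossNeg`, `κ > 2`: the tightness exhibit, cited not re-proved);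
nothing is «killed» unconditionally. CURRENCY (cell rule C3(e)): `wallMainTerm` is the MODEL main term of registry
row E-034, whose derivation from Prop 7.1 is HEURISTIC («derivation», not a theorem); the verdict is a statement
about that model constant, not about the discrete mean.

**As an instance of the two-block criterion (Part 2).** `wallBandWorld K X : TwoBlockWorld KinkedBulk WallData`
(bulk block `𝔅(u)`, coupling `X(u,W)`, band block `|h⁺|²K[b]`): `wallMainTerm = pencil at s = 1`
(`wallBandWorld_pencil_one`), `WallCrossCS K X ↔ CrossSubordinate` (`wallCrossCS_iff`), `K ≥ 0 → BandNonneg`, hence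
the scaled null `∀ s, 0 ≤ q(s)` on every design (`wallBandWorld_null_of_cs`) and the located lever
(`wallBand_closes_needs_cross`: a design with `wallMainTerm < 0` and `K ≥ 0` exhibits `𝔅(u)·|h⁺|²K[b] < ‖X(u,W)‖²`).

**C2 / C4 (Part 3).** On the sub-class «no band» (`W = WallData.sharpCut`, `h⁺ = 0`) a subordinate cross term
vanishes and the verdict IS the `R̄` positivity `0 ≤ 𝔅(u)` (`wallMainTerm_sharpCut_of_cs`); every in-class piece of
`R⁺` is a bulk datum (`InClassPiece.kinked`). Witnesses: `g⋆ ⊕ flat h` (wall value `0`), and — the NEW coverage —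
the constant bulk `u ≡ 1` (wall value `u(1) = 1 ≠ 0`, `kinkedProfile_constOne`) continued by `flat 1` / `ramp 1`:
the literal plateau `𝟙_[0, 1+α̃]` crossing the wall (`familyWallBand_inClass_constOne_flat`).

Deliberately NOT here: any derivation of `K`, `X` (rows E-034/E-006); interior jumps (E-028, typer-2's
`KnifeEdgeJumpTerm`); the Λ-block (E-030); numeric certificates (none: structural). Axioms standard.
References: Zhang, arXiv:2211.02515v1, §2 (2.30), §7 Prop 7.1 (7.2) p.44, §8 Lemma 8.1
[cite: Zhang2022LandauSiegel, §2 (2.30), §7 Prop 7.1 (7.2), §8 Lemma 8.1]; cell files barrier/ASSIGNMENTS.md v1.15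
row S-E-p3-3, B-multi/PLAN.md v1.1 §6/§9, obj/EDREGISTRY.md rows E-005/E-006/E-034/E-035.
-/

noncomputable section

open Complex Real Set
open _root_.MeasureTheory

namespace Literature.NumberTheory.LFunctions.Zhang2022

namespace KnifeEdge

open Repair

/-! ### Part 1 — the family «wall/band designs, wall value free» and its decision -/

/-- **The family «wall/band designs» (B-multi M3, object of record truncated at the wall)**: designs `(u, u′, W)`;
class = `Repair.KinkedProfile u u'` (kinked `H¹` bulk on `[0,1]`, wall value `u(1)` FREE; NO analytic hypothesis);
verdict = for EVERY band functional `K` with `K ≥ 0` (slot E-005/E-034, the (B1) sign; discharged for `bandK`) and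
EVERY cross world `X` with `WallCrossCS K X` (slot E-006, kind (c)), the model constant
`wallMainTerm K X u u' W = 𝔅(u) + 2Re X(u,W) + |h⁺|²K[b]` is not negative. [cite: Zhang2022LandauSiegel, §7 Prop 7.1 (7.2), §8 Lemma 8.1] -/
def familyWallBand : DesignFamily where
  Design := (ℝ → ℂ) × (ℝ → ℂ) × WallData
  InClass d := KinkedProfile d.1 d.2.1
  Verdict d := ∀ (K : (ℝ → ℂ) → ℝ) (X : WallCross), (∀ b : ℝ → ℂ, 0 ≤ K b) → WallCrossCS K X →
    ¬ (wallMainTerm K X d.1 d.2.1 d.2.2 < 0)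

/-- **The wall/band family is decided** (`KnifeEdge.wallMainTerm_nonneg_of_cs`, p458037 — nothing re-proved).
[cite: Zhang2022LandauSiegel, §7 Prop 7.1 (7.2), §8 Lemma 8.1] -/
theorem familyWallBand_decided : familyWallBand.Decided :=
  fun d hd _ _ hK hX => not_lt.2 (wallMainTerm_nonneg_of_cs hK hX hd d.2.2)

/-- **`R⁺ ++ [wall/band family]` is decided** (`Repair.rplus_extend`). [cite: Zhang2022LandauSiegel, §7 Prop 7.1 (7.2)] -/
theorem rplus_wallBand_decided : ClassDecided (Rplus ++ [familyWallBand]) :=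
  rplus_extend familyWallBand_decided

variable {K : (ℝ → ℂ) → ℝ} {X : WallCross} {u u' : ℝ → ℂ}

/-- The verdict unbundled, in the `0 ≤` form: every wall/band design has a non-negative model constant in every
world with `K ≥ 0` and a subordinate cross term. [cite: Zhang2022LandauSiegel, §7 Prop 7.1 (7.2), §8 Lemma 8.1] -/
theorem familyWallBand_nonneg (hu : KinkedProfile u u') (W : WallData) (hK : ∀ b : ℝ → ℂ, 0 ≤ K b)
    (hX : WallCrossCS K X) : 0 ≤ wallMainTerm K X u u' W :=
  wallMainTerm_nonneg_of_cs hK hX hu W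

/-- … in particular for the TYPED band functional `K = bandK` (slot E-005/E-034 discharged by `bandK_nonneg`;
only the cross slot E-006 remains displayed). [cite: Zhang2022LandauSiegel, §7 Prop 7.1 (7.2), §8 Lemma 8.1] -/
theorem familyWallBand_nonneg_bandK (hu : KinkedProfile u u') (W : WallData) (hX : WallCrossCS bandK X) :
    0 ≤ wallMainTerm bandK X u u' W :=
  wallMainTerm_nonneg_of_cs bandK_nonneg hX hu W

/-- The verdict of record on a member, by name. [cite: Zhang2022LandauSiegel, §7 Prop 7.1 (7.2)] -/
theorem familyWallBand_verdict (hu : KinkedProfile u u') (W : WallData) : familyWallBand.Verdict (u, u', W) :=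
  familyWallBand_decided _ hu

/-! ### Part 2 — the wall/band family as an instance of the two-block criterion -/

/-- Bulk data of the wall/band world: kinked `H¹` profiles on `[0,1]` (wall value free).
[cite: Zhang2022LandauSiegel, §7 Prop 7.1 (7.2)] -/
abbrev KinkedBulk : Type := {p : (ℝ → ℂ) × (ℝ → ℂ) // KinkedProfile p.1 p.2}

/-- the zero profile as a kinked bulk datum. [cite: Zhang2022LandauSiegel, §7 Prop 7.1 (7.2)] -/
def KinkedBulk.zero : KinkedBulk := ⟨(fun _ => 0, fun _ => 0), kinkedProfile_zero⟩

/-- **The wall/band world of `(K, X)`**: bulk block `𝔅(u)`, coupling `X(u,W)`, band block `|h⁺|²·K[b]`.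
[cite: Zhang2022LandauSiegel, §7 Prop 7.1 (7.2), §8 Lemma 8.1] -/
def wallBandWorld (K : (ℝ → ℂ) → ℝ) (X : WallCross) : TwoBlockWorld KinkedBulk WallData where
  bulk p := mainTermForm p.1.1 p.1.2
  cross p W := X p.1.1 p.1.2 W
  band W := ‖W.hPlus‖ ^ 2 * K W.band

/-- `wallMainTerm` is the world's pencil at `s = 1`. [cite: Zhang2022LandauSiegel, §7 Prop 7.1 (7.2)] -/
theorem wallBandWorld_pencil_one (hu : KinkedProfile u u') (W : WallData) :
    (wallBandWorld K X).pencil ⟨(u, u'), hu⟩ W 1 = wallMainTerm K X u u' W := by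
  simp [TwoBlockWorld.pencil, twoBlockPencil, wallBandWorld, wallMainTerm]

/-- bulk blocks `≥ 0` in the wall/band world — a THEOREM (`𝔅 ⪰ 0` on kinked `H¹` profiles, any wall value).
[cite: Zhang2022LandauSiegel, §7 Prop 7.1 (7.2)] -/
theorem wallBandWorld_bulkNonneg : (wallBandWorld K X).BulkNonneg := fun p => mainTermForm_nonneg_of_isH1 p.2.isH1

/-- `K ≥ 0` gives the band slot of the world. [cite: Zhang2022LandauSiegel, §2 Lemma 2.3, (2.15)] -/
theorem wallBandWorld_bandNonneg (hK : ∀ b : ℝ → ℂ, 0 ≤ K b) : (wallBandWorld K X).BandNonneg :=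
  fun _ => mul_nonneg (sq_nonneg _) (hK _)

/-- The typer's `WallCrossCS K X` IS the cross slot of the world. [cite: Zhang2022LandauSiegel, §8 Lemma 8.1] -/
theorem wallCrossCS_iff : WallCrossCS K X ↔ (wallBandWorld K X).CrossSubordinate := by
  constructor
  · intro h p W
    exact h p.1.1 p.1.2 W p.2
  · intro h u u' W hu
    exact h ⟨(u, u'), hu⟩ W

/-- **The scaled null**: with `K ≥ 0` and a subordinate cross term, `q(s) = 𝔅(u)|s|² + 2Re(s·X(u,W)) + |h⁺|²K[b]`
is `≥ 0` for EVERY scalar `s` and every design (the criterion backwards; at `s = 1` it is the family verdict).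
[cite: Zhang2022LandauSiegel, §7 Prop 7.1 (7.2)] -/
theorem wallBandWorld_null_of_cs (hK : ∀ b : ℝ → ℂ, 0 ≤ K b) (hX : WallCrossCS K X) : (wallBandWorld K X).Null :=
  (TwoBlockWorld.null_iff ⟨KinkedBulk.zero⟩ wallBandWorld_bulkNonneg).2
    ⟨wallBandWorld_bandNonneg hK, wallCrossCS_iff.1 hX⟩

/-- **The criterion in the wall/band world**: no scaled design closes iff the band blocks are `≥ 0` and the cross
terms are subordinate. [cite: Zhang2022LandauSiegel, §7 Prop 7.1 (7.2)] -/
theorem wallBandWorld_null_iff :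
    (wallBandWorld K X).Null ↔ (wallBandWorld K X).BandNonneg ∧ (wallBandWorld K X).CrossSubordinate :=
  TwoBlockWorld.null_iff ⟨KinkedBulk.zero⟩ wallBandWorld_bulkNonneg

/-- A closing wall design (`EMultiBandCloses K X`) closes the world (at `s = 1`). [cite: Zhang2022LandauSiegel, §7 Prop 7.1 (7.2)] -/
theorem wallBandWorld_closes_of_eMultiBandCloses (h : EMultiBandCloses K X) : (wallBandWorld K X).Closes := by
  obtain ⟨u, u', W, hu, hneg⟩ := h
  exact ⟨⟨(u, u'), hu⟩, W, 1, by rwa [wallBandWorld_pencil_one hu W]⟩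

/-- **THE LEVER, LOCATED for M3**: a wall design that closes (`EMultiBandCloses K X`) while `K ≥ 0` exhibits a bulk ×
band cross term BEYOND ITS OWN CAUCHY–SCHWARZ MAXIMUM: `𝔅(u)·|h⁺|²K[b] < ‖X(u,W)‖²` (row E-035's content).
[cite: Zhang2022LandauSiegel, §8 Lemma 8.1] -/
theorem wallBand_closes_needs_cross (hK : ∀ b : ℝ → ℂ, 0 ≤ K b) (h : EMultiBandCloses K X) :
    ∃ (u u' : ℝ → ℂ) (W : WallData), KinkedProfile u u' ∧
      mainTermForm u u' * (‖W.hPlus‖ ^ 2 * K W.band) < ‖X u u' W‖ ^ 2 := by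
  obtain ⟨p, W, hlt⟩ := TwoBlockWorld.closes_needs_cross wallBandWorld_bulkNonneg (wallBandWorld_bandNonneg hK)
    (wallBandWorld_closes_of_eMultiBandCloses h)
  exact ⟨p.1.1, p.1.2, W, p.2, hlt⟩

/-- … equivalently: closing with `K ≥ 0` NEGATES the cross slot (cf. `KnifeEdge.wallCrossNeg_not_cs` for the E-035
shape with `κ > 2`). [cite: Zhang2022LandauSiegel, §8 Lemma 8.1] -/
theorem not_wallCrossCS_of_closes (hK : ∀ b : ℝ → ℂ, 0 ≤ K b) (h : EMultiBandCloses K X) : ¬ WallCrossCS K X :=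
  fun hX => not_eMultiBandCloses_of_cs hK hX h

/-- On a `𝔅`-KERNEL bulk (`𝔅(u) = 0`, e.g. `g⋆`: `Repair.mainTermForm_gStar`) a subordinate cross term VANISHES on
every band datum. [cite: Zhang2022LandauSiegel, §7 Prop 7.1 (7.2)] -/
theorem wallCross_eq_zero_of_kernelMode (hX : WallCrossCS K X) (hu : KinkedProfile u u') (h0 : mainTermForm u u' = 0)
    (W : WallData) : X u u' W = 0 :=
  TwoBlockWorld.cross_eq_zero_of_bulk_zero (W := wallBandWorld K X) (wallCrossCS_iff.1 hX) (p := ⟨(u, u'), hu⟩) W h0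

/-! ### Part 3 — extension (C2) and witnesses (C4) -/

/-- **C2 — the sub-class «no band» is `R̄`'s positivity**: for the sharp cut at the wall (`h⁺ = 0`) a subordinate
cross term vanishes and the model constant IS `𝔅(u)` (`≥ 0`: `mainTermForm_nonneg_of_isH1`).
[cite: Zhang2022LandauSiegel, §7 Prop 7.1 (7.2)] -/
theorem wallMainTerm_sharpCut_of_cs (hX : WallCrossCS K X) (hu : KinkedProfile u u') :
    wallMainTerm K X u u' WallData.sharpCut = mainTermForm u u' := by
  have h := hX u u' WallData.sharpCut hu
  rw [WallData.sharpCut_hPlus, norm_zero] at h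
  have h0 : X u u' WallData.sharpCut = 0 := by
    have : ‖X u u' WallData.sharpCut‖ ^ 2 = 0 := le_antisymm (by simpa using h) (sq_nonneg _)
    exact norm_eq_zero.1 (pow_eq_zero_iff two_ne_zero |>.1 this)
  simp [wallMainTerm, h0]

/-- **C2 — every in-class piece of `R⁺` (p442741's `InClassPiece`, wall value `0`) is a bulk datum of the
wall/band family**, with any band datum. [cite: Zhang2022LandauSiegel, §7 Prop 7.1 (7.2)] -/
theorem familyWallBand_inClass_of_inClassPiece (hu : InClassPiece u u') (W : WallData) :
    familyWallBand.InClass (u, u', W) :=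
  hu.kinked

/-- the constant bulk `u ≡ 1` (derivative `0`) is a kinked profile — wall value `u(1) = 1 ≠ 0`.
[cite: Zhang2022LandauSiegel, §7 Prop 7.1 (7.2)] -/
theorem kinkedProfile_constOne : KinkedProfile (fun _ => (1:ℂ)) (fun _ => (0:ℂ)) where
  cont := continuousOn_const
  hasDeriv := fun x _ => hasDerivWithinAt_const x _ _
  memLp := by simp

/-- **C4 — the NEW coverage: a member whose wall value is not zero** — the constant bulk `u ≡ 1` (`u(1) = 1`)
continued FLAT at height `1` through the band (the literal plateau `𝟙_[0,1+α̃]` crossing the wall), and the same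
bulk with the ramp band. [cite: Zhang2022LandauSiegel, §2 (2.30), §7 Prop 7.1 (7.2)] -/
theorem familyWallBand_inClass_constOne_flat :
    familyWallBand.InClass (fun _ => (1:ℂ), fun _ => (0:ℂ), WallData.flat 1)
    ∧ familyWallBand.InClass (fun _ => (1:ℂ), fun _ => (0:ℂ), WallData.ramp 1)
    ∧ (fun _ : ℝ => (1:ℂ)) 1 ≠ 0 :=
  ⟨kinkedProfile_constOne, kinkedProfile_constOne, one_ne_zero⟩

/-- **C4 — a member with wall value zero** (the old coverage, for contrast): `g⋆ ⊕ flat h`.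
[cite: Zhang2022LandauSiegel, §7 Prop 7.1 (7.2)] -/
theorem familyWallBand_inClass_gStar_flat (h : ℂ) : familyWallBand.InClass (gStar, gStar', WallData.flat h) :=
  inClassPiece_gStar.kinked

/-- … on which, `g⋆` being a `𝔅`-kernel mode, a subordinate cross world contributes NOTHING and the model constant is
the bare band variance `|h|²·K[𝟙]` (for `K = bandK`: `|h|²`). [cite: Zhang2022LandauSiegel, §7 Prop 7.1 (7.2)] -/
theorem wallMainTerm_gStar_flat_of_cs (hX : WallCrossCS K X) (h : ℂ) :
    wallMainTerm K X gStar gStar' (WallData.flat h) = ‖h‖ ^ 2 * K (fun _ => 1) := by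
  have h0 := wallCross_eq_zero_of_kernelMode hX inClassPiece_gStar.kinked mainTermForm_gStar (WallData.flat h)
  rw [wallMainTerm, mainTermForm_gStar, h0]
  simp [WallData.flat]

/-- **Tightness, cited** (p458037): the cross slot is load-bearing — an E-035 cross term with `κ > 2` closes
(`eMultiBandCloses_of_crossNeg`) and therefore is not subordinate (`wallCrossNeg_not_cs`); restated for the family:
such a world violates the un-slotted verdict on some member. [cite: Zhang2022LandauSiegel, §8 Lemma 8.1] -/
theorem familyWallBand_slot_loadBearing {κ : ℝ} (hκ : 2 < κ) (h : WallCrossNeg κ K X) :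
    ∃ d : familyWallBand.Design, familyWallBand.InClass d ∧ wallMainTerm K X d.1 d.2.1 d.2.2 < 0 := by
  obtain ⟨u, u', W, hu, hneg⟩ := eMultiBandCloses_of_crossNeg hκ h
  exact ⟨(u, u', W), hu, hneg⟩

/-! ### Part 4 — the slots are INHABITED and LOAD-BEARING, concretely (referee pre-brief §0b-v3 (iii)–(iv)) -/

section Exhibits

/-- **C2 by term at `X = 0`**: for the sharp cut (`h⁺ = 0`) in the zero cross world the model constant IS `𝔅(u)`,
whatever the wall value `u(1)`. [cite: Zhang2022LandauSiegel, §7 Prop 7.1 (7.2)] -/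
theorem wallMainTerm_zero_sharpCut (K : (ℝ → ℂ) → ℝ) (u u' : ℝ → ℂ) :
    wallMainTerm K 0 u u' WallData.sharpCut = mainTermForm u u' := by
  simp [wallMainTerm]

/-- The zero cross world is subordinate whenever `K ≥ 0`. [cite: Zhang2022LandauSiegel, §8 Lemma 8.1] -/
theorem wallCrossCS_zero (hK : ∀ b : ℝ → ℂ, 0 ≤ K b) : WallCrossCS K 0 := by
  intro u u' W hu
  simp only [Pi.zero_apply, norm_zero, ne_eq, OfNat.ofNat_ne_zero, not_false_eq_true, zero_pow]
  exact mul_nonneg (mainTermForm_nonneg_of_isH1 hu.isH1) (mul_nonneg (sq_nonneg _) (hK _))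

/-- **Slots INHABITED**: with the typed band functional `K = bandK` (`≥ 0`: `bandK_nonneg`, E-005/E-034) and the zero
cross world (`X = 0`, E-006 trivially subordinate) both displayed hypotheses of `familyWallBand`'s verdict hold.
[cite: Zhang2022LandauSiegel, §8 Lemma 8.1] -/
theorem exists_slots_wallBand :
    ∃ (K : (ℝ → ℂ) → ℝ) (X : WallCross), (∀ b : ℝ → ℂ, 0 ≤ K b) ∧ WallCrossCS K X :=
  ⟨bandK, 0, bandK_nonneg, wallCrossCS_zero bandK_nonneg⟩

/-- **`𝔅(𝟙) = 40π`**: the constant bulk `u ≡ 1` (wall value `1`) has main-term form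
`88π·‖1‖² − 24π·Re(conj 1·(1+1)) = 40π` (all other terms of `mainTermForm_eq` vanish: `u′ = 0`, real primitive).
[cite: Zhang2022LandauSiegel, §7 Prop 7.1 (7.2)] -/
theorem mainTermForm_constOne : mainTermForm (fun _ => (1:ℂ)) (fun _ => (0:ℂ)) = 40 * π := by
  rw [mainTermForm_eq]
  have e1 : ∫ x in (0:ℝ)..1, (starRingEnd ℂ) (∫ t in (0:ℝ)..x, (1:ℂ)) = (((1/2 : ℝ)) : ℂ) := by
    have : (fun x : ℝ => (starRingEnd ℂ) (∫ t in (0:ℝ)..x, (1:ℂ))) = fun x : ℝ => ((x : ℝ) : ℂ) := by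
      funext x
      rw [intervalIntegral.integral_const, sub_zero, Complex.real_smul, mul_one, Complex.conj_ofReal]
    rw [this, intervalIntegral.integral_ofReal, integral_id]
    norm_num
  have e2 : ∫ t in (0:ℝ)..1, (1:ℂ) = 1 := by
    rw [intervalIntegral.integral_const, sub_zero, one_smul]
  have e3 : ∫ x in (0:ℝ)..1, (1:ℝ) = 1 := by rw [intervalIntegral.integral_const, sub_zero, smul_eq_mul, mul_one]
  simp only [norm_zero, ne_eq, OfNat.ofNat_ne_zero, not_false_eq_true, zero_pow, intervalIntegral.integral_zero,
    mul_zero, Complex.zero_im, add_zero, norm_one, one_pow, e2, map_one, one_mul,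
    Complex.add_re, Complex.one_re, mul_one, Complex.one_im]
  rw [e1, e3, Complex.ofReal_im]
  ring

/-- the bulk block of the constant profile is POSITIVE. [cite: Zhang2022LandauSiegel, §7 Prop 7.1 (7.2)] -/
theorem mainTermForm_constOne_pos : 0 < mainTermForm (fun _ => (1:ℂ)) (fun _ => (0:ℂ)) := by
  rw [mainTermForm_constOne]; positivity

/-- **The concrete E-035 world** (`κ = 3 > 2`): a constant cross value `X ≡ −60π` (so `2Re X = −120π = −3·𝔅(𝟙)`).
A bookkeeping exhibit — NOT a claim that any derivation produces it. [cite: Zhang2022LandauSiegel, §8 Lemma 8.1] -/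
def crossNegWorld : WallCross := fun _ _ _ => ((-(60 * π) : ℝ) : ℂ)

/-- The saturated band datum for the constant bulk: flat band at height `√(40π)`, so `|h⁺|²·K[𝟙] = 40π = 𝔅(𝟙)`.
[cite: Zhang2022LandauSiegel, §2 (2.30)] -/
def saturatedFlat : WallData := WallData.flat ((Real.sqrt (40 * π) : ℝ) : ℂ)

/-- `|h⁺|² = 40π` for the saturated flat band. [cite: Zhang2022LandauSiegel, §2 (2.30)] -/
theorem norm_sq_saturatedFlat_hPlus : ‖saturatedFlat.hPlus‖ ^ 2 = 40 * π := by
  rw [saturatedFlat, WallData.flat_hPlus, Complex.norm_real, Real.norm_eq_abs, sq_abs,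
    Real.sq_sqrt (by positivity)]

/-- **LOAD-BEARING, concretely**: in the world `(K, X) = (bandK, X ≡ −60π)` (`K ≥ 0` holds) the member
`(u ≡ 1, saturated flat band)` of `familyWallBand` — wall value `1 ≠ 0` — has model constant
`𝔅(𝟙) + 2Re X + |h⁺|²K[𝟙] = 40π − 120π + 40π = −40π < 0`. So the cross slot E-006 cannot be dropped from the verdict.
[cite: Zhang2022LandauSiegel, §8 Lemma 8.1] -/
theorem wallMainTerm_constOne_exhibit :
    wallMainTerm bandK crossNegWorld (fun _ => (1:ℂ)) (fun _ => (0:ℂ)) saturatedFlat = -(40 * π) := by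
  rw [wallMainTerm, mainTermForm_constOne, norm_sq_saturatedFlat_hPlus]
  have hb : bandK saturatedFlat.band = 1 := bandK_flat _
  rw [hb, crossNegWorld, Complex.ofReal_re]
  ring

/-- … it is a genuine instance of the E-035 shape `WallCrossNeg 3 bandK X` (saturation `|h⁺|²K = 𝔅(u) > 0`,
`2Re X ≤ −3·𝔅(u)`), exhibited — not assumed. [cite: Zhang2022LandauSiegel, §8 Lemma 8.1] -/
theorem wallCrossNeg_three_exhibit : WallCrossNeg 3 bandK crossNegWorld := by
  refine ⟨fun _ => (1:ℂ), fun _ => (0:ℂ), saturatedFlat, kinkedProfile_constOne, mainTermForm_constOne_pos, ?_, ?_⟩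
  · rw [norm_sq_saturatedFlat_hPlus, mainTermForm_constOne]
    have hb : bandK saturatedFlat.band = 1 := bandK_flat _
    rw [hb, mul_one]
  · rw [mainTermForm_constOne, crossNegWorld, Complex.ofReal_re]
    nlinarith [Real.pi_pos]

/-- … hence the wall class CLOSES in that world (`EMultiBandCloses bandK X`), … [cite: Zhang2022LandauSiegel, §8 Lemma 8.1] -/
theorem eMultiBandCloses_exhibit : EMultiBandCloses bandK crossNegWorld :=
  ⟨fun _ => (1:ℂ), fun _ => (0:ℂ), saturatedFlat, kinkedProfile_constOne, by
    rw [wallMainTerm_constOne_exhibit]; have := Real.pi_pos; linarith⟩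

/-- … the cross slot FAILS there, … [cite: Zhang2022LandauSiegel, §8 Lemma 8.1] -/
theorem not_wallCrossCS_exhibit : ¬ WallCrossCS bandK crossNegWorld :=
  not_wallCrossCS_of_closes bandK_nonneg eMultiBandCloses_exhibit

/-- … and the verdict of `familyWallBand` with the cross slot DELETED is FALSE on a member (the slot is load-bearing;
compare `exists_slots_wallBand`: the slot is also inhabited). [cite: Zhang2022LandauSiegel, §8 Lemma 8.1] -/
theorem familyWallBand_unslotted_fails :
    ∃ d : familyWallBand.Design, familyWallBand.InClass d ∧
      ¬ (∀ (K : (ℝ → ℂ) → ℝ) (X : WallCross), (∀ b : ℝ → ℂ, 0 ≤ K b) → ¬ (wallMainTerm K X d.1 d.2.1 d.2.2 < 0)) := by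
  refine ⟨((fun _ => (1:ℂ)), (fun _ => (0:ℂ)), saturatedFlat), kinkedProfile_constOne, fun h => ?_⟩
  refine h bandK crossNegWorld bandK_nonneg ?_
  show wallMainTerm bandK crossNegWorld (fun _ => (1:ℂ)) (fun _ => (0:ℂ)) saturatedFlat < 0
  rw [wallMainTerm_constOne_exhibit]
  have := Real.pi_pos
  linarith

end Exhibits

end KnifeEdge

end Literature.NumberTheory.LFunctions.Zhang2022
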